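import Summits.QuantumFields.BalabanUV.Beta.HarmonicGradientInterior

/-!
# Beta / HarmonicSecondDifference — SECOND DIFFERENCES OF LATTICE-HARMONIC FUNCTIONS ON A TORUS BOX:
# `|∂_ν∂_μ u(x₀)| ≤ K_d²·max_{dist ≤ 4R+4}|u|∕(R+1)²` — GR1 iterated once (the translate of a harmonic function is harmonic), i.e. the
# Hölder∕second-order member's SHAPE `(L^jη)^{−2}` for the FLAT constant-weight Laplacian at MODEL level (chain «LATTICE-GRADIENT-MEMBER»,
# O.2 item (i); source-free case only — with a bounded source the second differences of the potential carry a logarithm, which is why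
# print states the member in Hölder norms)

WHAT IS CERTIFIED (kernel, 0 sorry).  Unit torus `UT N`, constant weight `c ≡ c₀ ≠ 0`, flat transport; HARMONIC = `W·u = Nu` (files 12∕14
shape).  **`harmonic_fdiff_bound_ball`** — GR1 at every centre of a ball: `u` harmonic with `|u| ≤ M` on `dist(·,x₀) ≤ 4R+4` ⟹
`|u(x+e_μ) − u(x)| ≤ K_d·M∕(R+1)` for all `x` with `dist(x,x₀) ≤ 2R+2`; **`harmonic_sdiff_le`** — under the same hypotheses (`R ≥ 1`,
`10R+4 ≤ N_i`), for all axes `μ, ν`: **`|u(x₀+e_μ+e_ν) − u(x₀+e_μ) − u(x₀+e_ν) + u(x₀)| ≤ K_d²·M∕(R+1)²`** (GR1 `harmonic_fdiff_le` applied to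
`v = u(·+e_μ) − u`, harmonic one step in by `harmonic_shift_sub`).
(unit `b2b-balaban-beta-d4-p2`, GEN 11, MODEL crew; claim «LATTICE-GRADIENT-MEMBER» journal l.23681.)

HONEST FRAMING: discharging `BetaPertH` makes Bałaban's UV stability UNCONDITIONAL — NOT the continuum limit, NOT the Clay problem.
HONEST DEPENDENCY (verbatim): «continuum YM on T⁴ ⇐ BetaPertH ∧ nine spine estimates (0/9 proved); BetaPertH ⇐ (D1) ∧ (D4) ∧ CAP+tail;
G-an2-4 gates asym, D1 and NE2/3/4.»  THIS MODULE DISCHARGES NOTHING of `BetaPertH`, asserts NOTHING printed and cites nothing as a fact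
(ABSOLUTE RULE): [folklore] finite lattice calculus about the FREE torus Laplacian (constant weight, U = 1).  LOCATORS (shape only):
[Balaban1985BackgroundPropagators] Thm 3.1 (3.42) p. 397; [Balaban1983RegularityDecay] Lemma 2.2 (2.17) p. 577.  No class change on row D4
(critical-path width 0; D4 DISCHARGE NO DATE); NOT BetaPertH, NOT continuum, NOT Clay, NOT summit progress.
-/

open scoped BigOperators
open Finset

namespace Summit.QuantumFields.BalabanUV.Beta.HarmonicSecondDifference

open Literature.MathematicalPhysics.QuantumFieldTheory.Balaban1983to89
open Literature.MathematicalPhysics.QuantumFieldTheory.Balaban1983to89.B9Thm37GluePU (bsrc btgt)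
open B5TorusCover (UT)
open B5Leibniz121 (up)
open Summit.QuantumFields.BalabanUV.Beta.HarmonicGradientInterior (Kgrad harmonic_fdiff_le harmonic_shift_sub dist_up_le_add_one)
open Summit.QuantumFields.BalabanUV.Beta.SubsolutionMeanValueBox (Cmv_pos)

noncomputable section

variable {d : ℕ} {N : Fin d → ℕ} [∀ i, NeZero (N i)]

/-- **GR1 AT EVERY CENTRE OF A BALL**: `c ≡ c₀ ≠ 0`, `R ≥ 1`, `10R+4 ≤ N_i`, `u` harmonic with `|u| ≤ M` on `dist(·,x₀) ≤ 4R+4` ⟹ for every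
`x` with `dist(x,x₀) ≤ 2R+2` and every axis: `|u(x+e_μ) − u(x)| ≤ K_d·M∕(R+1)` (the ball of radius `2R+2` around `x` lies in the big one).
[folklore] -/
theorem harmonic_fdiff_bound_ball [NeZero d] {c : UT N × Fin d → ℝ} {c₀ : ℝ} (hc : ∀ b, c b = c₀) (hc₀ : c₀ ≠ 0) (x₀ : UT N) {R : ℕ}
    (hR : 1 ≤ R) (hN : ∀ i, 10 * R + 4 ≤ N i) (u : UT N → ℝ)
    (hu : ∀ x ∈ univ.filter (fun x : UT N => dist x x₀ ≤ 4 * R + 4),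
      ((∑ b ∈ univ.filter (fun b : UT N × Fin d => btgt b = x), c b ^ 2) +
          ∑ b ∈ univ.filter (fun b : UT N × Fin d => bsrc b = x), c b ^ 2) * u x =
        ((∑ b ∈ univ.filter (fun b : UT N × Fin d => btgt b = x), c b ^ 2 * u (bsrc b)) +
          ∑ b ∈ univ.filter (fun b : UT N × Fin d => bsrc b = x), c b ^ 2 * u (btgt b)))
    {M : ℝ} (hM : ∀ x ∈ univ.filter (fun x : UT N => dist x x₀ ≤ 4 * R + 4), |u x| ≤ M)
    (x : UT N) (hx : dist x x₀ ≤ 2 * R + 2) (μ : Fin d) :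
    |u (up x μ) - u x| ≤ Kgrad d * M / ((R : ℝ) + 1) := by
  have hsub : ∀ y : UT N, dist y x ≤ 2 * R + 2 → y ∈ univ.filter (fun y : UT N => dist y x₀ ≤ 4 * R + 4) := by
    intro y hy
    refine Finset.mem_filter.mpr ⟨Finset.mem_univ _, ?_⟩
    have := dist_triangle y x x₀
    linarith
  exact harmonic_fdiff_le hc hc₀ x hR hN u (fun y hy => hu y (hsub y (Finset.mem_filter.mp hy).2))
    (fun y hy => hM y (hsub y (Finset.mem_filter.mp hy).2)) μ

/-- **SECOND DIFFERENCES OF A LATTICE-HARMONIC FUNCTION (free torus Laplacian, constant weight, flat transport).**  `c ≡ c₀ ≠ 0`, `R ≥ 1`,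
`10R+4 ≤ N_i`, `u` harmonic with `|u| ≤ M` on `dist(·,x₀) ≤ 4R+4`.  Then for all axes `μ, ν`:
`|u(x₀+e_μ+e_ν) − u(x₀+e_μ) − u(x₀+e_ν) + u(x₀)| ≤ K_d²·M∕(R+1)²` — GR1 applied to the forward difference `v = u(·+e_μ) − u`, which is
harmonic on `dist ≤ 2R+3` (translation) and bounded there by `K_d·M∕(R+1)` (GR1 at every centre).
[cite: Balaban1985BackgroundPropagators, Thm 3.1 (3.42) p.397] [folklore] -/
theorem harmonic_sdiff_le [NeZero d] {c : UT N × Fin d → ℝ} {c₀ : ℝ} (hc : ∀ b, c b = c₀) (hc₀ : c₀ ≠ 0) (x₀ : UT N) {R : ℕ}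
    (hR : 1 ≤ R) (hN : ∀ i, 10 * R + 4 ≤ N i) (u : UT N → ℝ)
    (hu : ∀ x ∈ univ.filter (fun x : UT N => dist x x₀ ≤ 4 * R + 4),
      ((∑ b ∈ univ.filter (fun b : UT N × Fin d => btgt b = x), c b ^ 2) +
          ∑ b ∈ univ.filter (fun b : UT N × Fin d => bsrc b = x), c b ^ 2) * u x =
        ((∑ b ∈ univ.filter (fun b : UT N × Fin d => btgt b = x), c b ^ 2 * u (bsrc b)) +
          ∑ b ∈ univ.filter (fun b : UT N × Fin d => bsrc b = x), c b ^ 2 * u (btgt b)))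
    {M : ℝ} (hM : ∀ x ∈ univ.filter (fun x : UT N => dist x x₀ ≤ 4 * R + 4), |u x| ≤ M) (μ ν : Fin d) :
    |u (up (up x₀ μ) ν) - u (up x₀ μ) - u (up x₀ ν) + u x₀| ≤ Kgrad d ^ 2 * M / ((R : ℝ) + 1) ^ 2 := by
  have hd1 : 1 ≤ d := Nat.one_le_iff_ne_zero.mpr (NeZero.ne d)
  set v : UT N → ℝ := fun y => u (up y μ) - u y with hv
  -- `v` is harmonic on `dist ≤ 2R+2` (indeed on `dist ≤ 4R+3`)
  have hvh : ∀ x ∈ univ.filter (fun x : UT N => dist x x₀ ≤ 2 * R + 2),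
      ((∑ b ∈ univ.filter (fun b : UT N × Fin d => btgt b = x), c b ^ 2) +
          ∑ b ∈ univ.filter (fun b : UT N × Fin d => bsrc b = x), c b ^ 2) * v x =
        ((∑ b ∈ univ.filter (fun b : UT N × Fin d => btgt b = x), c b ^ 2 * v (bsrc b)) +
          ∑ b ∈ univ.filter (fun b : UT N × Fin d => bsrc b = x), c b ^ 2 * v (btgt b)) := by
    intro x hx
    have hxR := (Finset.mem_filter.mp hx).2
    have hR0 : (0 : ℝ) ≤ R := Nat.cast_nonneg R
    exact harmonic_shift_sub hc u μ x (hu x (Finset.mem_filter.mpr ⟨Finset.mem_univ _, by linarith⟩))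
      (hu (up x μ) (Finset.mem_filter.mpr ⟨Finset.mem_univ _, by linarith [dist_up_le_add_one x x₀ μ]⟩))
  -- `|v| ≤ K_d·M/(R+1)` on `dist ≤ 2R+2`
  have hvb : ∀ x ∈ univ.filter (fun x : UT N => dist x x₀ ≤ 2 * R + 2), |v x| ≤ Kgrad d * M / ((R : ℝ) + 1) :=
    fun x hx => harmonic_fdiff_bound_ball hc hc₀ x₀ hR hN u hu hM x (Finset.mem_filter.mp hx).2 μ
  have h := harmonic_fdiff_le hc hc₀ x₀ hR hN v hvh hvb ν
  have e1 : v (up x₀ ν) - v x₀ = u (up (up x₀ μ) ν) - u (up x₀ μ) - u (up x₀ ν) + u x₀ := by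
    simp only [hv]
    rw [HarmonicGradientInterior.up_up_comm x₀ ν μ]
    ring
  have e2 : Kgrad d * (Kgrad d * M / ((R : ℝ) + 1)) / ((R : ℝ) + 1) = Kgrad d ^ 2 * M / ((R : ℝ) + 1) ^ 2 := by
    have hR1 : (R : ℝ) + 1 ≠ 0 := by positivity
    field_simp
  rw [← e1, ← e2]
  exact h

end

end Summit.QuantumFields.BalabanUV.Beta.HarmonicSecondDifference
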